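import Literature.NumberTheory.Automorphic.Liu2021.SplitPlaceMixedModel
import Literature.RepresentationTheory.HeisenbergGroup.SchrodingerLeraySectionUnramified
import Literature.NumberTheory.Automorphic.LocalFieldHaarBalls
import HarnessLib

/-!
# The mixed model at a split place: `GL_N(F_v) ≅ U(J)(F_v)` as topological groups, and the character `η` has
# open kernel when `ω_s` is smooth

Topic `NumberTheory/Automorphic/Liu2021`; namespace `Literature.NumberTheory.Automorphic.Liu2021.SplitPlaceMixedModel`
(sequel of `SplitPlaceMixedModel.lean`).  KERNEL ONLY: theorems; no definition, no named fact, no `sorry`.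

* `exists_continuousMulEquiv_symm_map` — at a split place `w ∣ v` there is an isomorphism of topological groups
  `φ : GL_N(F_v) ≃ₜ* U(J)(F_v)` with `φ a = κ_a := localPiSplitEquiv.symm (a.map ι_w)` (`ι_w : F_v ≃ E_w`, `e = f = 1`);
* `leviOpPi_glEquiv_piBallSB_zero` — `r(m(b)) 1_{𝒪ᴺ} = 1_{𝒪ᴺ}` for `b ∈ GL_N(𝒪)` (`|det b| = 1`, `b⁻¹ 𝒪ᴺ = 𝒪ᴺ`);
* `isOpen_ker_of_mixedModel` — if `ω_s` is SMOOTH then the character `η` of the mixed model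
  (`exists_mixedModel`: `ω_s(κ_a) Φ = η(κ_a) • Γ⁻¹ r(m(a⁻ᵀ)) Γ Φ`) has OPEN kernel: on the open set
  `{κ_a : a⁻ᵀ ∈ GL_N(𝒪)} ∩ Stab_{ω_s}(Γ⁻¹ 1_{𝒪ᴺ})` both sides fix `Γ⁻¹ 1_{𝒪ᴺ} ≠ 0`, so `η = 1` there
  ([MoeglinVignerasWaldspurger1987, Chap. 2 II.8]: smooth representations; [GelbartRogawski1991, §3.1 Remark p. 457]).

Milestone (1b) of the KEY `b4-split-place-model` (cell hodgecm-mathlib); HC_CM is not mentioned further.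
-/

set_option autoImplicit false

noncomputable section

open NumberField IsDedekindDomain Matrix ValuativeRel
open _root_.MeasureTheory
open Literature.RepresentationTheory.HeisenbergGroup Literature.RepresentationTheory.HeisenbergGroup.SymplecticMatrix
open Literature.NumberTheory.Automorphic Literature.NumberTheory.Automorphic.UnitaryGroup
open Literature.NumberTheory.GelbartRogawski1991.UnitaryDualPair.LocalSplitting

namespace Literature.NumberTheory.Automorphic.Liu2021.SplitPlaceMixedModel

/-! ## §1 `GL_n` of a topological ring isomorphism -/

/-- A ring isomorphism `f : R ≃+* S` which is a homeomorphism induces an isomorphism of topological groups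
`GL_n(R) ≃ₜ* GL_n(S)`, `g ↦ g.map f`. [folklore] -/
private theorem exists_continuousMulEquiv_generalLinearGroup_map {n : Type*} [Fintype n] [DecidableEq n]
    {R S : Type*} [CommRing R] [CommRing S] [TopologicalSpace R] [TopologicalSpace S] [IsTopologicalRing R]
    [IsTopologicalRing S] (f : R ≃+* S) (hf : Continuous f) (hf' : Continuous f.symm) :
    ∃ Φ : GL n R ≃ₜ* GL n S, ∀ g, Φ g = Matrix.GeneralLinearGroup.map (f : R →+* S) g := by
  have h1 : Continuous (Matrix.GeneralLinearGroup.map (n := n) (f : R →+* S)) :=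
    Continuous.units_map _ (continuous_id.matrix_map hf)
  have h2 : Continuous (Matrix.GeneralLinearGroup.map (n := n) (f.symm : S →+* R)) :=
    Continuous.units_map _ (continuous_id.matrix_map hf')
  have hl : ∀ g : GL n R, Matrix.GeneralLinearGroup.map (f.symm : S →+* R)
      (Matrix.GeneralLinearGroup.map (f : R →+* S) g) = g := fun g =>
    Units.ext (Matrix.ext fun i j => f.symm_apply_apply _)
  have hr : ∀ g : GL n S, Matrix.GeneralLinearGroup.map (f : R →+* S)
      (Matrix.GeneralLinearGroup.map (f.symm : S →+* R) g) = g := fun g =>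
    Units.ext (Matrix.ext fun i j => f.apply_symm_apply _)
  exact ⟨{ toFun := Matrix.GeneralLinearGroup.map (f : R →+* S)
           invFun := Matrix.GeneralLinearGroup.map (f.symm : S →+* R)
           left_inv := hl
           right_inv := hr
           map_mul' := map_mul _
           continuous_toFun := h1
           continuous_invFun := h2 }, fun _ => rfl⟩

/-! ## §2 `GL_N(F_v) ≃ₜ* U(J)(F_v)` at a split place -/

section Place

variable (F : Type) [Field F] [NumberField F] (E : Type) [Field E] [NumberField E] [Algebra F E]
  [Algebra.IsQuadraticExtension F E] (c : E ≃ₐ[F] E) (N : ℕ) (J : Matrix (Fin N) (Fin N) E)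
  (v : HeightOneSpectrum (𝓞 F))

/-- **`GL_N(F_v) ≃ₜ* U(J)(F_v)` at a split place**: `a ↦ κ_a = localPiSplitEquiv.symm (a.map ι_w)` is an
isomorphism of topological groups, `ι_w : F_v → E_w` being a ring isomorphism and homeomorphism at a place of degree
one (`e(w|v) = f(w|v) = 1`, tree `adicCompletionEquivOfDegreeOne`). [cite: Mok2014, §1 Notation p. 5] -/
theorem exists_continuousMulEquiv_symm_map (hc : c ≠ 1) (hJc : (J.map c)ᵀ = J) (w : UnitaryGroup.PlacesOver E v)
    (hw : c • w.1 ≠ w.1) (hJw : IsUnit (placeForm J w.1)) :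
    ∃ φ : GL (Fin N) (v.adicCompletion F) ≃ₜ* localPi E c N J v,
      ∀ a, φ a = (localPiSplitEquiv c J hc hJc w hw hJw).symm (Matrix.GeneralLinearGroup.map (toPlace v w) a) := by
  haveI := UnitaryGroup.PlacesOver.liesOver w
  obtain ⟨he, hf⟩ := ramificationIdx_eq_one_and_inertiaDeg_eq_one_of_smul_ne F c hw
  obtain ⟨Φ, hΦ⟩ := exists_continuousMulEquiv_generalLinearGroup_map (n := Fin N)
    (adicCompletionEquivOfDegreeOne F E v w.1 he hf) (continuous_adicCompletionEquivOfDegreeOne F E v w.1 he hf)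
    (continuous_adicCompletionEquivOfDegreeOne_symm F E v w.1 he hf)
  exact ⟨Φ.trans (localPiSplitEquiv c J hc hJc w hw hJw).symm, fun a => by
    rw [ContinuousMulEquiv.trans_apply, hΦ]; rfl⟩

/-! ## §3 `r(m(b))` fixes `1_{𝒪ᴺ}` for `b ∈ GL_N(𝒪)` -/

/-- `r(m(b)) 1_{𝒪ᴺ} = 1_{𝒪ᴺ}` for `b ∈ GL_N(𝒪_v)`: `|det b|^{1/2} = 1` and `b⁻¹ 𝒪ᴺ = 𝒪ᴺ`.
[cite: WeilBNT1967, Ch. II §2, Prop. 4] -/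
theorem leviOpPi_glEquiv_piBallSB_zero {b : GL (Fin N) (v.adicCompletion F)} (hb : b ∈ glInt N (v.adicCompletion F)) :
    leviOpPi (glEquiv b) (piBallSB (v.adicCompletion F) (Fin N) 0) = piBallSB (v.adicCompletion F) (Fin N) 0 := by
  obtain ⟨u, rfl⟩ := hb
  have hf : ∀ r : 𝒪[v.adicCompletion F], (𝒪[v.adicCompletion F]).subtype r ∈ primePowBall (v.adicCompletion F) 0 :=
    fun r => LocalFieldHaar.mem_primePowBall_zero_iff.2 r.2
  have hent : ∀ (a : GL (Fin N) (v.adicCompletion F)) (i j : Fin N),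
      LinearMap.toMatrix' ((glEquiv a : (Fin N → v.adicCompletion F) ≃ₗ[v.adicCompletion F]
        (Fin N → v.adicCompletion F)) : (Fin N → v.adicCompletion F) →ₗ[v.adicCompletion F]
        (Fin N → v.adicCompletion F)) i j = (a : Matrix (Fin N) (Fin N) (v.adicCompletion F)) i j := by
    intro a i j
    rw [LinearMap.toMatrix'_apply, LinearEquiv.coe_coe, glEquiv_apply, Matrix.mulVec_single_one, Matrix.col_apply]
  have hdet : modSqrt (glEquiv (Matrix.GeneralLinearGroup.map (𝒪[v.adicCompletion F]).subtype u)) = 1 := by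
    refine modSqrt_eq_one_of_integral _ (fun i j => ?_) (fun i j => ?_)
    · rw [hent]
      exact hf _
    · have : (glEquiv (Matrix.GeneralLinearGroup.map (𝒪[v.adicCompletion F]).subtype u)).symm =
          glEquiv (Matrix.GeneralLinearGroup.map (𝒪[v.adicCompletion F]).subtype u⁻¹) := by
        apply LinearEquiv.ext; intro x; rw [glEquiv_symm_apply, glEquiv_apply, map_inv]
      rw [this, hent]
      exact hf _
  rw [leviOpPi, LinearEquiv.mul_apply, leviEquivSB_map_integersIndicator _ hf _ (coe_piBallSB 0) u]
  apply Subtype.ext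
  rw [scalarOp_apply, Units.val_inv_eq_inv_val, coe_modSqrtUnit, hdet, Complex.ofReal_one, inv_one, one_smul]

/-- `GL_N(𝒪)` is stable under the contragredient `b ↦ b⁻ᵀ`. [folklore] -/
private theorem contragredient_mem_glInt {b : GL (Fin N) (v.adicCompletion F)} (hb : b ∈ glInt N (v.adicCompletion F)) :
    GLn.contragredient b ∈ glInt N (v.adicCompletion F) := by
  rw [mem_glInt_iff] at hb ⊢
  refine ⟨fun i j => ?_, fun i j => ?_⟩
  · rw [GLn.coe_contragredient, Matrix.transpose_apply]; exact hb.2 j i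
  · rw [GLn.coe_contragredient_inv, Matrix.transpose_apply]; exact hb.1 j i

/-! ## §4 `ker η` is open when `ω_s` is smooth -/

/-- **If `ω_s` is SMOOTH, the character `η` of the mixed model has OPEN KERNEL.**  On the open subset
`{κ_a : a⁻ᵀ ∈ GL_N(𝒪_v)} ∩ Stab_{ω_s}(Φ₁)` of `U(J)(F_v)`, `Φ₁ = Γ⁻¹ 1_{𝒪ᴺ} ≠ 0`, both `ω_s(κ_a)` and
`Γ⁻¹ r(m(a⁻ᵀ)) Γ` fix `Φ₁`, so `η(κ_a) = 1`; a subgroup containing a neighbourhood of `1` is open.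
[cite: MoeglinVignerasWaldspurger1987, Chap. 2 II.8; GelbartRogawski1991, §3.1 Remark p. 457 L4–13] -/
theorem isOpen_ker_of_mixedModel {T : Matrix (Fin N) (Fin N) F} (hc : c ≠ 1) (hJc : (J.map c)ᵀ = J)
    (w : UnitaryGroup.PlacesOver E v) (hw : c • w.1 ≠ w.1) (hJw : IsUnit (placeForm J w.1))
    (s : localPi E c N J v →* LocalMp F N T v)
    (hsm : Representation.IsSmooth ((MpPsi.toRep (localSchrodinger F N T v)).comp s))
    (Γ : SchwartzBruhat (Fin N → v.adicCompletion F) ≃ₗ[ℂ] SchwartzBruhat (Fin N → v.adicCompletion F))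
    (η : localPi E c N J v →* ℂˣ)
    (hmodel : ∀ (a : GL (Fin N) (v.adicCompletion F)) (Φ : SchwartzBruhat (Fin N → v.adicCompletion F)),
      (MpPsi.toRep (localSchrodinger F N T v)).comp s
          ((localPiSplitEquiv c J hc hJc w hw hJw).symm (Matrix.GeneralLinearGroup.map (toPlace v w) a)) Φ =
        ((η ((localPiSplitEquiv c J hc hJc w hw hJw).symm (Matrix.GeneralLinearGroup.map (toPlace v w) a)) : ℂˣ) :
            ℂ) • Γ.symm (leviOpPi (glEquiv (GLn.contragredient a)) (Γ Φ))) :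
    IsOpen ((η.ker : Subgroup (localPi E c N J v)) : Set (localPi E c N J v)) := by
  obtain ⟨φ, hφ⟩ := exists_continuousMulEquiv_symm_map F E c N J v hc hJc w hw hJw
  set Φ₁ : SchwartzBruhat (Fin N → v.adicCompletion F) := Γ.symm (piBallSB (v.adicCompletion F) (Fin N) 0) with hΦ₁
  have hΦ₁0 : Φ₁ ≠ 0 := fun h => piBallSB_zero_ne_zero (Γ.symm.injective (h.trans (map_zero Γ.symm).symm))
  -- the open set `O = φ(contragredient⁻¹ GL_N(𝒪)) ∩ Stab(Φ₁)`
  set V : Set (GL (Fin N) (v.adicCompletion F)) := GLn.contragredient ⁻¹' (glInt N (v.adicCompletion F) : Set _) with hV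
  have hVo : IsOpen V := (isOpen_glInt N (v.adicCompletion F)).preimage GLn.continuous_contragredient
  set O : Set (localPi E c N J v) :=
    φ '' V ∩ (Representation.stabilizerSubgroup ((MpPsi.toRep (localSchrodinger F N T v)).comp s) Φ₁ :
      Set (localPi E c N J v)) with hO
  have hOo : IsOpen O := (φ.toHomeomorph.isOpenMap V hVo).inter (hsm Φ₁)
  have h1O : (1 : localPi E c N J v) ∈ O := by
    refine ⟨⟨1, ?_, map_one φ⟩, Subgroup.one_mem _⟩
    change GLn.contragredient 1 ∈ glInt N (v.adicCompletion F)
    rw [map_one]; exact Subgroup.one_mem _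
  have hOker : O ⊆ (η.ker : Set (localPi E c N J v)) := by
    rintro κ ⟨⟨a, ha, rfl⟩, hstab⟩
    rw [SetLike.mem_coe, MonoidHom.mem_ker]
    rw [SetLike.mem_coe, Representation.mem_stabilizerSubgroup, hφ, hmodel, hΦ₁, LinearEquiv.apply_symm_apply,
      leviOpPi_glEquiv_piBallSB_zero F N v ha] at hstab
    have h2 : ((η (φ a) : ℂˣ) : ℂ) • Φ₁ = (1 : ℂ) • Φ₁ := by rw [one_smul, hφ]; exact hstab
    exact Units.val_eq_one.1 (smul_left_injective ℂ hΦ₁0 h2)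
  exact Subgroup.isOpen_of_mem_nhds _ (Filter.mem_of_superset (hOo.mem_nhds h1O) hOker)

end Place

end Literature.NumberTheory.Automorphic.Liu2021.SplitPlaceMixedModel

end
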